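import Literature.Topology.Euclidean.PoincareHopfTorus
import Mathlib.Analysis.Calculus.BumpFunction.Basic
import Mathlib.Analysis.SpecialFunctions.Trigonometric.Deriv
import Mathlib.Algebra.Order.Round
import Mathlib.LinearAlgebra.Matrix.ToLin
import HarnessLib

/-!
# The index sum of a coercive vector field on a ball is one

Topic `Literature/Topology/Euclidean` (next to `PoincareHopfTorus.lean`). Let
`G : ℝⁿ⁺¹ → ℝⁿ⁺¹` (`ℝⁿ⁺¹ = Fin (n+1) → ℝ`, sup norm) be `C¹` and **coercive on an annulus**,
`∑ᵢ xᵢ Gᵢ(x) > 0` for `ρ ≤ ‖x‖ ≤ ρ'`. If the zeros of `G` in the open box `‖x‖ < ρ` are finitely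
many and non-degenerate then

  `∑_{G(z) = 0, ‖z‖ < ρ} sign det DG(z) = 1`

(`sum_sign_det_eq_one_of_coercive`): the Brouwer degree of a field pointing outward on the boundary
of a ball is `1 = χ(ball)` (Poincaré–Hopf with boundary, Milnor 1965 §6 p. 35; equivalently the
homotopy invariance of the degree, Chang 2005 Thm. 3.1.4, `deg(G, B, 0) = deg(id, B, 0) = 1`). In
particular (`exists_zero_ne_of_det_fderiv_neg`) a coercive field with a non-degenerate zero of
index `-1` has a SECOND zero in the ball — the parity argument by which non-trivial stationary
solutions are produced from an odd crossing number of the linearisation at a trivial one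
(Krasnosel'skii; used for the Galerkin systems of the Navier–Stokes equations in route
`AnomalousDissipation/WazewskiBlock`).

## Proof (reduction to the flat torus, `sum_sign_det_eq_zero_of_periodic`)

Glue `G` to the `T`-periodic sine field `S(x)ᵢ = (T/2π) sin(2πxᵢ/T)`, `T = 4ρ'`: with a product
cutoff `χ = ∏ᵢ θ(xᵢ)` (`θ = 1` on `[-ρ, ρ]`, `supp θ ⊆ (-ρ', ρ')`) put `g = χ · (G - S)` and
`H = S + P`, where `P(x) = g(x - T·round(x/T))` is the lattice periodisation of `g` (a `C¹` periodic
function because `supp g` lies in the open box of radius `ρ' < T/2`: near every point `P` is a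
fixed translate of `g`, `contDiff_comp_sub_round`). In the period cell `[-T/2, T/2)ⁿ⁺¹`, `H = G` on
`‖x‖ < ρ`, `H` has no zeros on `ρ ≤ ‖x‖ ≤ ρ'` (both `x·G > 0` and `x·S > 0` there), and `H = S`
elsewhere, whose zeros in the cell are the `2ⁿ⁺¹ - 1` points with coordinates in `{0, -T/2}` not all
zero, of index `(-1)^{#{i : xᵢ = -T/2}}`, summing to `(1 - 1)ⁿ⁺¹ - 1 = -1`. The torus theorem gives
`∑_Z sign det DG - 1 = 0`.

## References

* J. Milnor, *Topology from the Differentiable Viewpoint* (1965), §6 (Poincaré–Hopf, p. 35). [Milnor1965]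
* K.-C. Chang, *Methods in Nonlinear Analysis* (2005), §3.1, Thm. 3.1.4 (homotopy invariance,
  normalisation of the Brouwer degree). [Chang2005]
* M. A. Krasnosel'skii, *Topological Methods in the Theory of Nonlinear Integral Equations* (1964),
  Ch. II §4 (index of a non-degenerate zero, existence of a second solution).
-/

noncomputable section

open Set Function Metric Filter Real Finset
open scoped Topology BigOperators

namespace Literature.Topology.Euclidean

variable {n : ℕ}

/-! ### Lattice periodisation of a compactly supported function -/

/-- Distinct integers nearest to two reals closer than `1/2 - σ`: if `round u ≠ round v` and
`|u - v| < 1/2 - σ` then `u` is at distance `≥ 1/2` from `round v` and `> σ` from `round u`.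
[folklore] -/
theorem half_le_abs_sub_round_of_round_ne {u v σ : ℝ} (huv : |u - v| < 1 / 2 - σ)
    (hne : round u ≠ round v) : 1 / 2 ≤ |u - round v| ∧ σ < |u - round u| := by
  have hkl : (1 : ℝ) ≤ |(round u : ℝ) - round v| := by
    have h : (1 : ℤ) ≤ |round u - round v| := Int.one_le_abs (sub_ne_zero.2 hne)
    exact_mod_cast h
  have h1 : |u - round u| ≤ |u - round v| := round_le u (round v)
  have h2 : |v - round v| ≤ |v - round u| := round_le v (round u)
  have htri1 : |(round u : ℝ) - round v| ≤ |u - round u| + |u - round v| := by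
    calc |(round u : ℝ) - round v| = |(u - round v) - (u - round u)| := by ring_nf
      _ ≤ |u - round v| + |u - round u| := abs_sub _ _
      _ = |u - round u| + |u - round v| := add_comm _ _
  have htri2 : |(round u : ℝ) - round v| ≤ |v - round u| + |v - round v| := by
    calc |(round u : ℝ) - round v| = |(v - round v) - (v - round u)| := by ring_nf
      _ ≤ |v - round v| + |v - round u| := abs_sub _ _
      _ = |v - round u| + |v - round v| := add_comm _ _
  have hvk : 1 / 2 ≤ |v - round u| := by linarith
  have htri3 : |v - round u| ≤ |u - v| + |u - round u| := by
    calc |v - round u| = |(u - round u) - (u - v)| := by ring_nf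
      _ ≤ |u - round u| + |u - v| := abs_sub _ _
      _ = |u - v| + |u - round u| := add_comm _ _
  constructor
  · linarith
  · linarith

/-- **Smoothness of the lattice periodisation.** If `g : ℝⁿ⁺¹ → F` is `C^k` and vanishes at every
point having a coordinate of modulus `≥ s`, where `s < T/2`, then the `Tℤⁿ⁺¹`-periodisation
`x ↦ g(x - T·round(x/T))` is `C^k`: on the sup-ball of radius `T/2 - s` around any `x₀` it coincides
with the fixed translate `x ↦ g(x - T·round(x₀/T))` (where the roundings differ, both points have a
coordinate of modulus `≥ s`). [folklore] -/
theorem contDiff_comp_sub_round {F : Type*} [NormedAddCommGroup F] [NormedSpace ℝ F] {k : WithTop ℕ∞}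
    {T s : ℝ} (hT : 0 < T) (hs : s < T / 2) {g : (Fin (n + 1) → ℝ) → F} (hg : ContDiff ℝ k g)
    (hsupp : ∀ x, (∃ i, s ≤ |x i|) → g x = 0) :
    ContDiff ℝ k (fun x => g (x - fun i => T * (round (x i / T) : ℝ))) := by
  refine contDiff_iff_contDiffAt.2 fun x₀ => ?_
  set j : Fin (n + 1) → ℝ := fun i => T * (round (x₀ i / T) : ℝ) with hj
  have hsmooth : ContDiff ℝ k (fun x => g (x - j)) := hg.comp (contDiff_id.sub contDiff_const)
  refine hsmooth.contDiffAt.congr_of_eventuallyEq ?_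
  have hball : Metric.ball x₀ (T / 2 - s) ∈ 𝓝 x₀ := Metric.ball_mem_nhds _ (by linarith)
  filter_upwards [hball] with y hy
  rw [Metric.mem_ball] at hy
  by_cases hround : (fun i => T * (round (y i / T) : ℝ)) = j
  · simp only [hround]
  · -- some coordinate is rounded differently: both values vanish
    obtain ⟨i, hi⟩ : ∃ i, round (y i / T) ≠ round (x₀ i / T) := by
      by_contra h
      push Not at h
      exact hround (funext fun i => by simp [hj, h i])
    have hyi : |y i / T - x₀ i / T| < 1 / 2 - s / T := by
      have h1 : |y i - x₀ i| < T / 2 - s := by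
        have := (norm_le_pi_norm (y - x₀) i)
        rw [Real.norm_eq_abs, Pi.sub_apply, ← dist_eq_norm] at this
        exact this.trans_lt hy
      rw [← sub_div, abs_div, abs_of_pos hT, div_lt_iff₀ hT]
      have h2 : (1 / 2 - s / T) * T = T / 2 - s := by
        rw [sub_mul, div_mul_cancel₀ _ hT.ne']
        ring
      rwa [h2]
    obtain ⟨ha, hb⟩ := half_le_abs_sub_round_of_round_ne hyi hi
    have hzero1 : g (y - fun i => T * (round (y i / T) : ℝ)) = 0 := by
      refine hsupp _ ⟨i, ?_⟩
      simp only [Pi.sub_apply]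
      have : y i - T * (round (y i / T) : ℝ) = T * (y i / T - round (y i / T)) := by
        field_simp
      rw [this, abs_mul, abs_of_pos hT]
      have := (div_lt_iff₀ hT).1 hb
      nlinarith
    have hzero2 : g (y - j) = 0 := by
      refine hsupp _ ⟨i, ?_⟩
      simp only [Pi.sub_apply, hj]
      have : y i - T * (round (x₀ i / T) : ℝ) = T * (y i / T - round (x₀ i / T)) := by
        field_simp
      rw [this, abs_mul, abs_of_pos hT]
      nlinarith
    rw [hzero1, hzero2]

/-- The lattice periodisation is `T`-periodic in each coordinate. [folklore] -/
theorem comp_sub_round_add_single {F : Type*} {T : ℝ} (hT : T ≠ 0) (g : (Fin (n + 1) → ℝ) → F)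
    (x : Fin (n + 1) → ℝ) (i : Fin (n + 1)) :
    g (x + Pi.single i T - fun l => T * (round ((x + Pi.single i T : Fin (n + 1) → ℝ) l / T) : ℝ)) =
      g (x - fun l => T * (round (x l / T) : ℝ)) := by
  congr 1
  ext l
  by_cases hl : l = i
  · subst hl
    simp only [Pi.sub_apply, Pi.add_apply, Pi.single_eq_same]
    rw [add_div, div_self hT, round_add_one]
    push_cast
    ring
  · simp [Pi.single_eq_of_ne hl]

/-- On the half-open period cell `[-T/2, T/2)ⁿ⁺¹` the periodisation is the function itself.
[folklore] -/
theorem comp_sub_round_of_mem_Ico {F : Type*} {T : ℝ} (hT : 0 < T) (g : (Fin (n + 1) → ℝ) → F)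
    {x : Fin (n + 1) → ℝ} (hx : ∀ i, x i ∈ Ico (-(T / 2)) (T / 2)) :
    g (x - fun l => T * (round (x l / T) : ℝ)) = g x := by
  congr 1
  ext l
  have h0 : round (x l / T) = 0 := by
    rw [round_eq_zero_iff]
    obtain ⟨h1, h2⟩ := hx l
    constructor
    · rw [le_div_iff₀ hT]; linarith
    · rw [div_lt_iff₀ hT]; linarith
  simp [h0]

/-- The periodisation vanishes at points with a coordinate at distance `≥ s` from `Tℤ`. [folklore] -/
theorem comp_sub_round_eq_zero {F : Type*} [Zero F] {T s : ℝ} (g : (Fin (n + 1) → ℝ) → F)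
    (hsupp : ∀ x, (∃ i, s ≤ |x i|) → g x = 0) {x : Fin (n + 1) → ℝ}
    (hx : ∃ i, ∀ m : ℤ, s ≤ |x i - T * m|) :
    g (x - fun l => T * (round (x l / T) : ℝ)) = 0 := by
  obtain ⟨i, hi⟩ := hx
  exact hsupp _ ⟨i, by simpa using hi (round (x i / T))⟩

/-! ### The periodic sine field -/

/-- The sine field `S(x)ᵢ = (T/2π) sin(2πxᵢ/T)` is smooth. [folklore] -/
theorem contDiff_sineField (T : ℝ) {k : WithTop ℕ∞} :
    ContDiff ℝ k (fun (x : Fin (n + 1) → ℝ) (i : Fin (n + 1)) => T / (2 * π) * Real.sin (2 * π * x i / T)) := by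
  refine contDiff_pi.2 fun i => contDiff_const.mul (Real.contDiff_sin.comp ?_)
  exact (contDiff_const.mul (contDiff_apply ℝ ℝ i)).div_const T

/-- The sine field is `T`-periodic in each coordinate. [folklore] -/
theorem sineField_add_single {T : ℝ} (hT : T ≠ 0) (x : Fin (n + 1) → ℝ) (i : Fin (n + 1)) :
    (fun (x : Fin (n + 1) → ℝ) (l : Fin (n + 1)) => T / (2 * π) * Real.sin (2 * π * x l / T))
        (x + Pi.single i T) =
      (fun (x : Fin (n + 1) → ℝ) (l : Fin (n + 1)) => T / (2 * π) * Real.sin (2 * π * x l / T)) x := by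
  ext l
  by_cases hl : l = i
  · subst hl
    simp only [Pi.add_apply, Pi.single_eq_same]
    have : 2 * π * (x l + T) / T = 2 * π * x l / T + 2 * π := by field_simp
    rw [this, Real.sin_add_two_pi]
  · simp [Pi.single_eq_of_ne hl]

/-- `t · sin(2πt/T) ≥ 0` for `|t| < T/2`, with equality only at `t = 0`. [folklore] -/
theorem mul_sin_nonneg_of_abs_lt {T t : ℝ} (hT : 0 < T) (ht : |t| < T / 2) :
    0 ≤ t * Real.sin (2 * π * t / T) ∧ (t ≠ 0 → 0 < t * Real.sin (2 * π * t / T)) := by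
  have hab := abs_lt.1 ht
  have hpi : 2 * π * t / T < π := by
    rw [div_lt_iff₀ hT]; nlinarith [Real.pi_pos]
  have hpi' : -π < 2 * π * t / T := by
    rw [lt_div_iff₀ hT]; nlinarith [Real.pi_pos]
  rcases lt_trichotomy t 0 with h | h | h
  · have hneg : Real.sin (2 * π * t / T) < 0 := by
      have : 0 < Real.sin (-(2 * π * t / T)) :=
        Real.sin_pos_of_pos_of_lt_pi (by
          have : 2 * π * t / T < 0 := div_neg_of_neg_of_pos (by nlinarith [Real.pi_pos]) hT
          linarith) (by linarith)
      rw [Real.sin_neg] at this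
      linarith
    exact ⟨(mul_pos_of_neg_of_neg h hneg).le, fun _ => mul_pos_of_neg_of_neg h hneg⟩
  · subst h; simp
  · have hpos : 0 < Real.sin (2 * π * t / T) :=
      Real.sin_pos_of_pos_of_lt_pi (div_pos (by nlinarith [Real.pi_pos]) hT) hpi
    exact ⟨(mul_pos h hpos).le, fun _ => mul_pos h hpos⟩

/-- The sine field points outward: `∑ᵢ xᵢ S(x)ᵢ > 0` for `x ≠ 0` in the open box `|xᵢ| < T/2`.
[folklore] -/
theorem sum_mul_sineField_pos {T : ℝ} (hT : 0 < T) {x : Fin (n + 1) → ℝ} (hx : ∀ i, |x i| < T / 2)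
    (hx0 : x ≠ 0) : 0 < ∑ i, x i * (T / (2 * π) * Real.sin (2 * π * x i / T)) := by
  obtain ⟨i₀, hi₀⟩ : ∃ i, x i ≠ 0 := by
    by_contra h
    push Not at h
    exact hx0 (funext h)
  have hc : 0 < T / (2 * π) := by positivity
  have hterm : ∀ i, 0 ≤ x i * (T / (2 * π) * Real.sin (2 * π * x i / T)) := fun i => by
    have := (mul_sin_nonneg_of_abs_lt hT (hx i)).1
    calc (0 : ℝ) ≤ T / (2 * π) * (x i * Real.sin (2 * π * x i / T)) := mul_nonneg hc.le this
      _ = _ := by ring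
  have hi₀' : 0 < x i₀ * (T / (2 * π) * Real.sin (2 * π * x i₀ / T)) := by
    have := (mul_sin_nonneg_of_abs_lt hT (hx i₀)).2 hi₀
    calc (0 : ℝ) < T / (2 * π) * (x i₀ * Real.sin (2 * π * x i₀ / T)) := mul_pos hc this
      _ = _ := by ring
  calc (0 : ℝ) < x i₀ * (T / (2 * π) * Real.sin (2 * π * x i₀ / T)) := hi₀'
    _ ≤ ∑ i, x i * (T / (2 * π) * Real.sin (2 * π * x i / T)) :=
        Finset.single_le_sum (fun i _ => hterm i) (Finset.mem_univ i₀)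

/-- The zeros of the sine field in the period cell `[-T/2, T/2)ⁿ⁺¹` have all coordinates in
`{0, -T/2}`. [folklore] -/
theorem sineField_coord_eq_zero_or {T : ℝ} (hT : 0 < T) {x : Fin (n + 1) → ℝ}
    (hx : ∀ i, x i ∈ Ico (-(T / 2)) (T / 2))
    (h0 : (fun (l : Fin (n + 1)) => T / (2 * π) * Real.sin (2 * π * x l / T)) = 0) (i : Fin (n + 1)) :
    x i = 0 ∨ x i = -(T / 2) := by
  have hi : T / (2 * π) * Real.sin (2 * π * x i / T) = 0 := congrFun h0 i
  have hsin : Real.sin (2 * π * x i / T) = 0 := by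
    rcases mul_eq_zero.1 hi with h | h
    · exfalso; have : 0 < T / (2 * π) := by positivity
      linarith
    · exact h
  obtain ⟨m, hm⟩ := Real.sin_eq_zero_iff.1 hsin
  have hxm : x i = m * T / 2 := by
    have hπ : π ≠ 0 := Real.pi_ne_zero
    field_simp at hm
    nlinarith [hm, Real.pi_pos]
  obtain ⟨h1, h2⟩ := hx i
  rw [hxm] at h1 h2
  have hm1 : (-1 : ℝ) ≤ m := by nlinarith
  have hm2 : (m : ℝ) < 1 := by nlinarith
  have hm1' : (-1 : ℤ) ≤ m := by exact_mod_cast hm1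
  have hm2' : m < 1 := by exact_mod_cast hm2
  have : m = -1 ∨ m = 0 := by omega
  rcases this with rfl | rfl
  · right; rw [hxm]; push_cast; ring
  · left; rw [hxm]; push_cast; ring

/-- The derivative of the sine field: the diagonal map `v ↦ (cos(2πxᵢ/T) vᵢ)ᵢ`. [folklore] -/
theorem hasFDerivAt_sineField {T : ℝ} (hT : T ≠ 0) (x : Fin (n + 1) → ℝ) :
    HasFDerivAt (fun (x : Fin (n + 1) → ℝ) (i : Fin (n + 1)) => T / (2 * π) * Real.sin (2 * π * x i / T))
      (ContinuousLinearMap.pi fun i =>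
        Real.cos (2 * π * x i / T) • ContinuousLinearMap.proj (R := ℝ) (φ := fun _ : Fin (n + 1) => ℝ) i) x := by
  refine hasFDerivAt_pi.2 fun i => ?_
  have hlin : HasFDerivAt (fun y : Fin (n + 1) → ℝ => 2 * π * y i / T)
      ((2 * π / T) • ContinuousLinearMap.proj (R := ℝ) (φ := fun _ : Fin (n + 1) => ℝ) i) x := by
    have hfun : (fun y : Fin (n + 1) → ℝ => 2 * π * y i / T) =
        fun y => (2 * π / T) • (ContinuousLinearMap.proj (R := ℝ) (φ := fun _ : Fin (n + 1) => ℝ) i) y := by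
      funext y
      simp only [ContinuousLinearMap.proj_apply, smul_eq_mul]
      ring
    rw [hfun]
    exact ((ContinuousLinearMap.proj (R := ℝ) (φ := fun _ : Fin (n + 1) => ℝ) i).hasFDerivAt).const_smul
      (2 * π / T)
  have hsin := (Real.hasDerivAt_sin (2 * π * x i / T)).comp_hasFDerivAt x hlin
  have h := hsin.const_mul (T / (2 * π))
  refine h.congr_fderiv ?_
  rw [smul_smul, smul_smul]
  congr 1
  have hπ : (π : ℝ) ≠ 0 := Real.pi_ne_zero
  field_simp

/-- The determinant of a diagonal continuous linear map `v ↦ (cᵢ vᵢ)ᵢ` on `ℝⁿ⁺¹` is `∏ᵢ cᵢ`.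
[folklore] -/
theorem det_pi_smul_proj (c : Fin (n + 1) → ℝ) :
    (ContinuousLinearMap.pi fun i =>
        c i • ContinuousLinearMap.proj (R := ℝ) (φ := fun _ : Fin (n + 1) => ℝ) i).det = ∏ i, c i := by
  have h : ((ContinuousLinearMap.pi fun i =>
      c i • ContinuousLinearMap.proj (R := ℝ) (φ := fun _ : Fin (n + 1) => ℝ) i :
        (Fin (n + 1) → ℝ) →L[ℝ] Fin (n + 1) → ℝ) : (Fin (n + 1) → ℝ) →ₗ[ℝ] Fin (n + 1) → ℝ) =
      Matrix.toLin' (Matrix.diagonal c) := by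
    ext v i
    simp [Matrix.mulVec_diagonal]
  rw [ContinuousLinearMap.det, h, LinearMap.det_toLin', Matrix.det_diagonal]

/-! ### The index theorem -/

/-- **The index sum of a coercive field on a ball is `1`.** Let `G : ℝⁿ⁺¹ → ℝⁿ⁺¹` (sup norm) be
`C¹` with `∑ᵢ xᵢ Gᵢ(x) > 0` whenever `ρ ≤ ‖x‖ ≤ ρ'` (`0 < ρ < ρ'`), and let `Z` be a finite set of
non-degenerate zeros of `G` in the open box `‖x‖ < ρ` containing all zeros of `G` there. Then
`∑_{z ∈ Z} sign det DG(z) = 1` (Brouwer degree of an outward field; Milnor 1965 §6, Chang 2005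
Thm. 3.1.4). Proof: glue `G` to the periodic sine field and apply the flat-torus index theorem
`sum_sign_det_eq_zero_of_periodic`; see the module docstring. [cite: Chang2005, §3.1 Thm 3.1.4] -/
theorem sum_sign_det_eq_one_of_coercive {G : (Fin (n + 1) → ℝ) → Fin (n + 1) → ℝ}
    (hG : ContDiff ℝ 1 G) {ρ ρ' : ℝ} (hρ : 0 < ρ) (hρρ' : ρ < ρ')
    (hcoer : ∀ x, ρ ≤ ‖x‖ → ‖x‖ ≤ ρ' → 0 < ∑ i, x i * G x i)
    {Z : Finset (Fin (n + 1) → ℝ)} (hZ : ∀ x, ‖x‖ < ρ → G x = 0 → x ∈ Z)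
    (hZ0 : ∀ z ∈ Z, G z = 0 ∧ ‖z‖ < ρ) (hnd : ∀ z ∈ Z, (fderiv ℝ G z).det ≠ 0) :
    ∑ z ∈ Z, Real.sign (fderiv ℝ G z).det = 1 := by
  classical
  have hρ' : 0 < ρ' := hρ.trans hρρ'
  -- the period and the auxiliary fields
  set T : ℝ := 4 * ρ' with hTdef
  have hT : 0 < T := by positivity
  have hT0 : T ≠ 0 := hT.ne'
  have hT2 : ρ' < T / 2 := by rw [hTdef]; linarith
  set S : (Fin (n + 1) → ℝ) → Fin (n + 1) → ℝ :=
    fun x i => T / (2 * π) * Real.sin (2 * π * x i / T) with hSdef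
  let θ : ContDiffBump (0 : ℝ) := ⟨ρ, ρ', hρ, hρρ'⟩
  set χ : (Fin (n + 1) → ℝ) → ℝ := fun x => ∏ i, θ (x i) with hχdef
  set g : (Fin (n + 1) → ℝ) → Fin (n + 1) → ℝ := fun x => χ x • (G x - S x) with hgdef
  set H : (Fin (n + 1) → ℝ) → Fin (n + 1) → ℝ :=
    fun x => S x + g (x - fun l => T * (round (x l / T) : ℝ)) with hHdef
  -- the cutoff
  have hχ_smooth : ContDiff ℝ 1 χ :=
    contDiff_prod fun i _ => (θ.contDiff (n := 1)).comp (contDiff_apply ℝ ℝ i)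
  have hχ_one : ∀ x : Fin (n + 1) → ℝ, (∀ i, |x i| ≤ ρ) → χ x = 1 := fun x hx => by
    refine Finset.prod_eq_one fun i _ => θ.one_of_mem_closedBall ?_
    simpa [Real.dist_eq] using hx i
  have hχ_zero : ∀ x : Fin (n + 1) → ℝ, (∃ i, ρ' ≤ |x i|) → χ x = 0 := fun x ⟨i, hi⟩ =>
    Finset.prod_eq_zero (Finset.mem_univ i) (θ.zero_of_le_dist (by simpa [Real.dist_eq] using hi))
  have hχ_nonneg : ∀ x, 0 ≤ χ x := fun x => Finset.prod_nonneg fun i _ => θ.nonneg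
  have hχ_le : ∀ x, χ x ≤ 1 := fun x => Finset.prod_le_one (fun i _ => θ.nonneg) fun i _ => θ.le_one
  -- the glue and its periodisation
  have hS_smooth : ContDiff ℝ 1 S := contDiff_sineField T
  have hg_smooth : ContDiff ℝ 1 g := hχ_smooth.smul (hG.sub hS_smooth)
  have hg_supp : ∀ x, (∃ i, ρ' ≤ |x i|) → g x = 0 := fun x hx => by
    simp only [hgdef, hχ_zero x hx, zero_smul]
  have hH_smooth : ContDiff ℝ 1 H :=
    hS_smooth.add (contDiff_comp_sub_round hT hT2 hg_smooth hg_supp)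
  have hH_per : ∀ x i, H (x + Pi.single i T) = H x := fun x i => by
    simp only [hHdef]
    rw [comp_sub_round_add_single hT0 g x i]
    congr 1
    exact sineField_add_single hT0 x i
  -- `H` on the cell, on the small box, near the lattice points
  have hH_cell : ∀ x : Fin (n + 1) → ℝ, (∀ i, x i ∈ Ico (-(T / 2)) (T / 2)) →
      H x = χ x • G x + (1 - χ x) • S x := fun x hx => by
    simp only [hHdef, hgdef, comp_sub_round_of_mem_Ico hT _ hx]
    simp only [smul_sub, sub_smul, one_smul]
    abel
  have hbox_open : IsOpen {y : Fin (n + 1) → ℝ | ∀ i, |y i| < ρ} := by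
    have : {y : Fin (n + 1) → ℝ | ∀ i, |y i| < ρ} = Metric.ball 0 ρ := by
      ext y
      rw [Metric.mem_ball, dist_zero_right, pi_norm_lt_iff hρ]
      simp [Real.norm_eq_abs]
    rw [this]; exact Metric.isOpen_ball
  have hH_eq_G : ∀ y : Fin (n + 1) → ℝ, (∀ i, |y i| < ρ) → H y = G y := fun y hy => by
    have hy' : ∀ i, y i ∈ Ico (-(T / 2)) (T / 2) := fun i => by
      have := abs_lt.1 (hy i); constructor <;> linarith
    rw [hH_cell y hy', hχ_one y fun i => (hy i).le]
    simp
  have hH_eventually_G : ∀ z : Fin (n + 1) → ℝ, ‖z‖ < ρ → H =ᶠ[𝓝 z] G := fun z hz => by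
    have hz' : ∀ i, |z i| < ρ := fun i => by
      have := norm_le_pi_norm z i; rw [Real.norm_eq_abs] at this; linarith
    filter_upwards [hbox_open.mem_nhds hz'] with y hy using hH_eq_G y hy
  -- the lattice zeros
  set zI : Finset (Fin (n + 1)) → (Fin (n + 1) → ℝ) := fun I i => if i ∈ I then -(T / 2) else 0
    with hzIdef
  have hzI_far : ∀ (I : Finset (Fin (n + 1))) (i : Fin (n + 1)), i ∈ I → ∀ (y : Fin (n + 1) → ℝ),
      dist y (zI I) < T / 2 - ρ' → ∀ m : ℤ, ρ' ≤ |y i - T * m| := by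
    intro I i hi y hy m
    have h1 : |y i - zI I i| < T / 2 - ρ' := by
      have := norm_le_pi_norm (y - zI I) i
      rw [Real.norm_eq_abs, Pi.sub_apply, ← dist_eq_norm] at this
      exact this.trans_lt hy
    have hzi : zI I i = -(T / 2) := by simp [hzIdef, hi]
    rw [hzi] at h1
    have h2 : T / 2 ≤ |-(T / 2) - T * m| := by
      have : -(T / 2) - T * (m : ℝ) = -(T * (m + 1 / 2)) := by ring
      rw [this, abs_neg, abs_mul, abs_of_pos hT]
      have hm : (1 : ℝ) / 2 ≤ |(m : ℝ) + 1 / 2| := by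
        rcases le_or_gt 0 m with h | h
        · have : (0 : ℝ) ≤ m := by exact_mod_cast h
          rw [abs_of_nonneg (by linarith)]; linarith
        · have hm' : m ≤ -1 := by omega
          have : (m : ℝ) ≤ -1 := by exact_mod_cast hm'
          rw [abs_of_neg (by linarith)]; linarith
      nlinarith
    have h3 : |-(T / 2) - T * m| ≤ |y i - -(T / 2)| + |y i - T * m| := by
      calc |-(T / 2) - T * m| = |(y i - T * m) - (y i - -(T / 2))| := by ring_nf
        _ ≤ |y i - T * m| + |y i - -(T / 2)| := abs_sub _ _
        _ = _ := add_comm _ _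
    linarith
  have hH_eventually_S : ∀ I : Finset (Fin (n + 1)), I.Nonempty → H =ᶠ[𝓝 (zI I)] S := by
    intro I hI
    obtain ⟨i, hi⟩ := hI
    have hball : Metric.ball (zI I) (T / 2 - ρ') ∈ 𝓝 (zI I) := Metric.ball_mem_nhds _ (by linarith)
    filter_upwards [hball] with y hy
    rw [Metric.mem_ball] at hy
    simp only [hHdef, comp_sub_round_eq_zero g hg_supp ⟨i, hzI_far I i hi y hy⟩, add_zero]
  have hS_zI : ∀ I : Finset (Fin (n + 1)), S (zI I) = 0 := fun I => by
    ext i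
    simp only [hSdef, hzIdef, Pi.zero_apply]
    by_cases hi : i ∈ I
    · simp only [hi, if_true]
      have : 2 * π * -(T / 2) / T = -π := by field_simp
      rw [this, Real.sin_neg, Real.sin_pi]; simp
    · simp [hi]
  have hH_zI : ∀ I : Finset (Fin (n + 1)), I.Nonempty → H (zI I) = 0 := fun I hI => by
    rw [(hH_eventually_S I hI).eq_of_nhds, hS_zI]
  have hdet_zI : ∀ I : Finset (Fin (n + 1)), I.Nonempty →
      (fderiv ℝ H (zI I)).det = (-1) ^ I.card := fun I hI => by
    rw [(hH_eventually_S I hI).fderiv_eq, (hasFDerivAt_sineField hT0 (zI I)).fderiv, det_pi_smul_proj]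
    have hc : ∀ i, Real.cos (2 * π * zI I i / T) = if i ∈ I then -1 else 1 := fun i => by
      by_cases hi : i ∈ I
      · simp only [hzIdef, hi, if_true]
        have : 2 * π * -(T / 2) / T = -π := by field_simp
        rw [this, Real.cos_neg, Real.cos_pi]
      · simp [hzIdef, hi]
    simp_rw [hc]
    rw [Finset.prod_ite, Finset.prod_const, Finset.prod_const_one, mul_one]
    congr 1
    simp
  have hzI_inj : Function.Injective zI := fun I J hIJ => by
    ext i
    have h := congrFun hIJ i
    have hT2ne : -(T / 2) ≠ (0 : ℝ) := by
      have := half_pos hT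
      linarith
    by_cases hi : i ∈ I <;> by_cases hj : i ∈ J
    · simp [hi, hj]
    · simp only [hzIdef, hi, hj, if_true, if_false] at h; exact absurd h hT2ne
    · simp only [hzIdef, hi, hj, if_true, if_false] at h; exact absurd h.symm hT2ne
    · simp [hi, hj]
  set ZS : Finset (Fin (n + 1) → ℝ) := ((Finset.univ : Finset (Finset (Fin (n + 1)))).erase ∅).image zI
    with hZSdef
  have hmem_ZS : ∀ x, x ∈ ZS ↔ ∃ I : Finset (Fin (n + 1)), I.Nonempty ∧ zI I = x := fun x => by
    simp only [hZSdef, Finset.mem_image, Finset.mem_erase, Finset.mem_univ, and_true,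
      Finset.nonempty_iff_ne_empty]
  -- the zero set of `H` in the cell
  have hchar : ∀ x, x ∈ Z ∪ ZS ↔ (∀ i, x i ∈ Ico (-(T / 2)) (-(T / 2) + T)) ∧ H x = 0 := by
    intro x
    have hTT : -(T / 2) + T = T / 2 := by ring
    simp only [hTT, Finset.mem_union]
    constructor
    · rintro (hx | hx)
      · obtain ⟨hGx, hxρ⟩ := hZ0 x hx
        have hxi : ∀ i, |x i| < ρ := fun i => by
          have := norm_le_pi_norm x i; rw [Real.norm_eq_abs] at this; linarith
        refine ⟨fun i => ?_, by rw [hH_eq_G x hxi, hGx]⟩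
        have := abs_lt.1 (hxi i); constructor <;> linarith
      · obtain ⟨I, hI, rfl⟩ := (hmem_ZS x).1 hx
        refine ⟨fun i => ?_, hH_zI I hI⟩
        by_cases hi : i ∈ I
        · simp only [hzIdef, hi, if_true, Set.mem_Ico]; constructor <;> linarith
        · simp only [hzIdef, hi, if_false, Set.mem_Ico]; constructor <;> linarith
    · rintro ⟨hcell, hHx⟩
      have hcell' : ∀ i, |x i| ≤ T / 2 := fun i => by
        obtain ⟨h1, h2⟩ := hcell i; rw [abs_le]; constructor <;> linarith
      by_cases h1 : ‖x‖ < ρ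
      · -- small box: a zero of `G`
        left
        have hxi : ∀ i, |x i| < ρ := fun i => by
          have := norm_le_pi_norm x i; rw [Real.norm_eq_abs] at this; linarith
        exact hZ x h1 (by rw [← hH_eq_G x hxi, hHx])
      · push Not at h1
        by_cases h2 : ‖x‖ ≤ ρ'
        · -- annulus: no zeros
          exfalso
          have hx0 : x ≠ 0 := fun h => by rw [h, norm_zero] at h1; linarith
          have hxi : ∀ i, |x i| < T / 2 := fun i => by
            have := norm_le_pi_norm x i; rw [Real.norm_eq_abs] at this; linarith
          have hA := hcoer x h1 h2
          have hB := sum_mul_sineField_pos hT hxi hx0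
          have hsum : ∑ i, x i * H x i = χ x * ∑ i, x i * G x i + (1 - χ x) * ∑ i, x i * S x i := by
            rw [hH_cell x hcell, Finset.mul_sum, Finset.mul_sum, ← Finset.sum_add_distrib]
            refine Finset.sum_congr rfl fun i _ => ?_
            simp only [Pi.add_apply, Pi.smul_apply, smul_eq_mul]
            ring
          have hB' : 0 < ∑ i, x i * S x i := by simpa only [hSdef] using hB
          have hpos : 0 < ∑ i, x i * H x i := by
            rw [hsum]
            have hc0 := hχ_nonneg x
            have hc1 := hχ_le x
            nlinarith [mul_le_mul_of_nonneg_left (min_le_left (∑ i, x i * G x i) (∑ i, x i * S x i)) hc0,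
              mul_le_mul_of_nonneg_left (min_le_right (∑ i, x i * G x i) (∑ i, x i * S x i))
                (sub_nonneg.2 hc1), lt_min hA hB']
          rw [hHx] at hpos
          simp at hpos
        · -- outside: zeros of the sine field
          right
          push Not at h2
          obtain ⟨i₀, hi₀⟩ : ∃ i, ρ' < |x i| := by
            by_contra h
            push Not at h
            have : ‖x‖ ≤ ρ' := (pi_norm_le_iff_of_nonneg hρ'.le).2 fun i => by
              rw [Real.norm_eq_abs]; exact h i
            linarith
          have hχx : χ x = 0 := hχ_zero x ⟨i₀, hi₀.le⟩
          have hSx : S x = 0 := by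
            have := hH_cell x hcell
            rw [hHx, hχx] at this
            simpa using this.symm
          have hcoord := sineField_coord_eq_zero_or hT hcell hSx
          set I : Finset (Fin (n + 1)) := Finset.univ.filter fun i => x i = -(T / 2) with hIdef
          refine (hmem_ZS x).2 ⟨I, ⟨i₀, ?_⟩, ?_⟩
          · rw [hIdef, Finset.mem_filter]
            refine ⟨Finset.mem_univ _, ?_⟩
            rcases hcoord i₀ with h | h
            · exfalso; rw [h, abs_zero] at hi₀; linarith
            · exact h
          · ext i
            simp only [hzIdef, hIdef, Finset.mem_filter, Finset.mem_univ, true_and]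
            rcases hcoord i with h | h
            · rw [h]
              have : ¬ (0 : ℝ) = -(T / 2) := by intro h'; linarith
              simp [this]
            · simp [h]
  -- non-degeneracy on the glued zero set
  have hnd' : ∀ x ∈ Z ∪ ZS, (fderiv ℝ H x).det ≠ 0 := by
    intro x hx
    rcases Finset.mem_union.1 hx with hx | hx
    · rw [(hH_eventually_G x (hZ0 x hx).2).fderiv_eq]
      exact hnd x hx
    · obtain ⟨I, hI, rfl⟩ := (hmem_ZS x).1 hx
      rw [hdet_zI I hI]
      exact pow_ne_zero _ (by norm_num)
  -- the torus theorem
  have key := sum_sign_det_eq_zero_of_periodic hT (fun _ => -(T / 2)) hH_smooth hH_per (Z ∪ ZS)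
    hchar hnd'
  have hdisj : Disjoint Z ZS := by
    rw [Finset.disjoint_left]
    intro z hz hzS
    obtain ⟨I, ⟨i, hi⟩, rfl⟩ := (hmem_ZS z).1 hzS
    have h1 := (hZ0 _ hz).2
    have h2 : T / 2 ≤ ‖zI I‖ := by
      have := norm_le_pi_norm (zI I) i
      rw [Real.norm_eq_abs] at this
      simp only [hzIdef, hi, if_true, abs_neg, abs_of_pos (half_pos hT)] at this
      exact this
    linarith
  rw [Finset.sum_union hdisj] at key
  have hZsum : ∑ z ∈ Z, Real.sign (fderiv ℝ H z).det = ∑ z ∈ Z, Real.sign (fderiv ℝ G z).det :=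
    Finset.sum_congr rfl fun z hz => by rw [(hH_eventually_G z (hZ0 z hz).2).fderiv_eq]
  have hZSsum : ∑ z ∈ ZS, Real.sign (fderiv ℝ H z).det = -1 := by
    rw [hZSdef, Finset.sum_image fun I _ J _ h => hzI_inj h]
    have h1 : ∑ I ∈ (Finset.univ : Finset (Finset (Fin (n + 1)))).erase ∅,
        Real.sign (fderiv ℝ H (zI I)).det =
        ∑ I ∈ (Finset.univ : Finset (Finset (Fin (n + 1)))).erase ∅, ((-1 : ℝ) ^ I.card) := by
      refine Finset.sum_congr rfl fun I hI => ?_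
      have hIne : I.Nonempty := Finset.nonempty_iff_ne_empty.2 (Finset.mem_erase.1 hI).1
      rw [hdet_zI I hIne]
      rcases neg_one_pow_eq_or ℝ I.card with h | h <;> rw [h]
      · exact Real.sign_one
      · rw [Real.sign_neg, Real.sign_one]
    rw [h1]
    have h2 : ∑ I ∈ (Finset.univ : Finset (Finset (Fin (n + 1)))), ((-1 : ℝ) ^ I.card) = 0 := by
      rw [← Finset.powerset_univ]
      have := Finset.sum_powerset_neg_one_pow_card_of_nonempty (α := Fin (n + 1)) (x := Finset.univ)
        Finset.univ_nonempty
      exact_mod_cast this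
    have h3 := Finset.sum_erase_add (Finset.univ : Finset (Finset (Fin (n + 1))))
      (fun I => ((-1 : ℝ) ^ I.card)) (Finset.mem_univ ∅)
    rw [h2, Finset.card_empty, pow_zero] at h3
    linarith
  rw [hZsum, hZSsum] at key
  linarith

/-- **A coercive field with a zero of index `-1` has a second zero.** If `G : ℝⁿ⁺¹ → ℝⁿ⁺¹` is
`C¹`, coercive on the annulus `ρ ≤ ‖x‖ ≤ ρ'` (`∑ᵢ xᵢ Gᵢ(x) > 0` there), and has a zero `z₀`,
`‖z₀‖ < ρ`, with `det DG(z₀) < 0`, then `G` has another zero `z ≠ z₀` with `‖z‖ < ρ` (otherwise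
the index sum over `{z₀}` would be `-1 ≠ 1`; Krasnosel'skii's parity principle). [cite: Chang2005, §3.1 Thm 3.1.4] -/
theorem exists_zero_ne_of_det_fderiv_neg {G : (Fin (n + 1) → ℝ) → Fin (n + 1) → ℝ}
    (hG : ContDiff ℝ 1 G) {ρ ρ' : ℝ} (hρ : 0 < ρ) (hρρ' : ρ < ρ')
    (hcoer : ∀ x, ρ ≤ ‖x‖ → ‖x‖ ≤ ρ' → 0 < ∑ i, x i * G x i)
    {z₀ : Fin (n + 1) → ℝ} (hz₀ : G z₀ = 0) (hz₀ρ : ‖z₀‖ < ρ) (hdet : (fderiv ℝ G z₀).det < 0) :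
    ∃ z, z ≠ z₀ ∧ ‖z‖ < ρ ∧ G z = 0 := by
  classical
  by_contra h
  push Not at h
  have hZ : ∀ x, ‖x‖ < ρ → G x = 0 → x ∈ ({z₀} : Finset (Fin (n + 1) → ℝ)) := fun x hx hGx => by
    rw [Finset.mem_singleton]
    by_contra hne
    exact h x hne hx hGx
  have key := sum_sign_det_eq_one_of_coercive hG hρ hρρ' hcoer hZ
    (fun z hz => by rw [Finset.mem_singleton] at hz; subst hz; exact ⟨hz₀, hz₀ρ⟩)
    (fun z hz => by rw [Finset.mem_singleton] at hz; subst hz; exact hdet.ne)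
  rw [Finset.sum_singleton, Real.sign_of_neg hdet] at key
  norm_num at key

end Literature.Topology.Euclidean

end
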